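import Summits.QuantumFields.YangMills.Theses.OnsetCalibration
import Summits.QuantumFields.YangMills.Theorems.LangevinControlUVOSLegsFromFemtoAndGapStubCollar
import Summits.QuantumFields.YangMills.Theorems.LatticeGapInUVUnits.Negative.WeakCouplingConcentration
import Literature.MathematicalPhysics.QuantumFieldTheory.ActionDensityTimeReflection
import Literature.MathematicalPhysics.QuantumLattice.WilsonLoops

/-!
# Route `OnsetCalibration` — support item U `OnsetVanishes` (stmt-QuantumFields-23315)

`Summit.QuantumFields.YangMills.Theses.OnsetCalibration.OnsetVanishes`: for every datum `(G, r, v, f, g, h)`,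
every `ε > 0`, `Λ₅` and `s₀ > 0` there is `β₁` such that for `β ≥ β₁` NO resolution `s ∈ [s₀, 1]` carries the
two non-triviality floors (`ε ≤ Q2(θv, v)` and `ε ≤ |Q3(f,g,h)|` on all tori with `Λ₅ ≤ s·L`).

Proof (fixed-torus freezing).  Put `L₀ := ⌈Λ₅/s₀⌉₊`; then `Λ₅ ≤ s·L₀` for every `s ≥ s₀`, so the `Q2`-floor at
`s` would give `ε ≤ Q2 G r β L₀ s (θv) v`.  But `Q2 G r β L₀ s (θv) v = Σ_{x,y ∈ box} θv(s x) v(s y) Cov_β(A_x, A_y)`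
with the action densities `A_x` on the FIXED torus `(ℤ/(2L₀+1))⁴`; the test-function weights are bounded by
`‖θv‖_∞ ‖v‖_∞` uniformly in `s`, and every covariance tends to `0` as `β → ∞`: on the torus
`A_x = K − P_x` with `P_x = Σ_{i<j} (N − Re tr r(U_{p_{ij}(x)}))` a sum of six plaquette costs, so
`|Cov_β(A_x, A_y)| ≤ 2‖A‖_∞ · E_β[P_x]` and `E_β[P_x] → 0` by the tree's weak-coupling concentration on a fixed
torus (`LatticeGapInUVUnits.Negative.tendsto_wilsonExpectation_plaquetteCost`, Laplace principle for the Wilson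
weight against product Haar measure).  Hence `Q2 < ε` for `β` large, uniformly in `s ∈ [s₀, 1]`.

HONEST LABEL: a support item (M); with the landed Assembly (p585223) the leaf of the route (rung R2a-IV) rests on
the open cruxes K1 `OnsetFloors` and K2 `SubOnsetCeilings`.  No summit, no mass gap.
-/

set_option autoImplicit false

noncomputable section

open scoped SchwartzMap
open MeasureTheory Filter Topology
open Literature.MathematicalPhysics.QuantumFieldTheory Literature.MathematicalPhysics.QuantumLattice
open Literature.MathematicalPhysics.AQFT Literature.Probability.LatticeModels
open Summit.QuantumFields.YangMills.Cruxes.OSLegsFromFemtoAndGap.DlrCollarTransfer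

namespace Summit.QuantumFields.YangMills.Theorems.OnsetCalibration

variable {G : Type} [Group G] [TopologicalSpace G] [IsTopologicalGroup G] [CompactSpace G]
  [MeasurableSpace G] [BorelSpace G] (r : LatticeRep G)

/-- On the torus of side `S` (periodic lift), the action density at `x` is the sum over the six coordinate
planes `i < j` of `N − (plaquette cost of the torus plaquette p_{ij}(x̄))`. [folklore] -/
theorem dens_torusLift_eq_sum (S : ℕ) (x : Fin 4 → ℤ) (V : GaugeConfig 4 S G) :
    dens G r x (torusLift S V) =
      ∑ q : {q : Fin 4 × Fin 4 // q.1 < q.2}, ((r.N : ℝ) - plaquetteCost r.ρ V (Torus.proj S x, q)) := by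
  change actionDensity r.ρ (configShift (-x) (torusLift S V)) = _
  rw [actionDensity_eq_sum_subtype]
  refine Finset.sum_congr rfl fun q _ => ?_
  -- the plaquette holonomy of the translated periodic lift at the origin is the torus holonomy at `x̄`
  have h : plaquetteHolonomyZd (configShift (-x) (torusLift S V)) 0 q.1.1 q.1.2 =
      plaquetteHolonomy V (Torus.proj S x) q.1.1 q.1.2 := by
    have h1 : plaquetteHolonomyZd (configShift (-x) (torusLift S V)) 0 q.1.1 q.1.2 =
        plaquetteHolonomyZd (torusLift S V) x q.1.1 q.1.2 := by
      simp only [plaquetteHolonomyZd, Literature.MathematicalPhysics.QuantumLattice.configShift_apply, sub_neg_eq_add,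
        zero_add, add_comm (Pi.single _ _) x]
    rw [h1]
    simp only [plaquetteHolonomyZd, plaquetteHolonomy, torusLift, torusEdge, Function.comp_apply,
      Literature.MathematicalPhysics.QuantumFieldTheory.Site.shift, torusProj_add_single, Int.cast_one]
  simp only [Literature.MathematicalPhysics.QuantumLattice.plaquetteObs, h, plaquetteCost, sub_sub_cancel]

omit [IsTopologicalGroup G] [CompactSpace G] [MeasurableSpace G] [BorelSpace G] in
/-- The defect `P_x = Σ_{i<j} cost(p_{ij}(x̄))` of the action density on the torus is non-negative. [folklore] -/
theorem defect_nonneg (S : ℕ) [NeZero S] (x : Fin 4 → ℤ) (V : GaugeConfig 4 S G) :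
    0 ≤ ∑ q : {q : Fin 4 × Fin 4 // q.1 < q.2}, plaquetteCost r.ρ V (Torus.proj S x, q) :=
  Finset.sum_nonneg fun _ _ => LatticeGapInUVUnits.Negative.plaquetteCost_nonneg r V _

/-- **Weak-coupling decay of the action-density covariances on a fixed odd torus**: for every `L` and sites
`x, y`, `Cov_{β, 2L+1}(A_x, A_y) → 0` as `β → ∞` (`|Cov| ≤ 2‖A‖_∞ E[P_x]` and `E[P_x] → 0` plaquette by
plaquette). [folklore] -/
theorem tendsto_torusCov_dens (L : ℕ) (x y : Fin 4 → ℤ) :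
    Tendsto (fun β : ℝ => torusE G r β L (fun U => dens G r x U * dens G r y U) -
      torusE G r β L (dens G r x) * torusE G r β L (dens G r y)) atTop (𝓝 0) := by
  haveI : SecondCountableTopology G :=
    (r.continuous.isClosedEmbedding r.injective).isEmbedding.secondCountableTopology
  obtain ⟨C, hC⟩ := r.curvature.bounded
  have hCA : ∀ (z : Fin 4 → ℤ) (U : LGConfig 4 G), |dens G r z U| ≤ C := fun z U => hC _
  have hC0 : 0 ≤ C := (abs_nonneg _).trans (hCA x 1)
  -- the defect and its mean
  set S : ℕ := 2 * L + 1 with hS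
  let P : GaugeConfig 4 S G → ℝ := fun V =>
    ∑ q : {q : Fin 4 × Fin 4 // q.1 < q.2}, plaquetteCost r.ρ V (Torus.proj S x, q)
  have hP0 : ∀ V, 0 ≤ P V := fun V => defect_nonneg r S x V
  have hPc : Continuous P := continuous_finsetSum _ fun q _ =>
    LatticeGapInUVUnits.Negative.continuous_plaquetteCost r _
  have hPb : ∀ V, |P V| ≤ ∑ _q : {q : Fin 4 × Fin 4 // q.1 < q.2}, 2 * (r.N : ℝ) := fun V =>
    (Finset.abs_sum_le_sum_abs _ _).trans (Finset.sum_le_sum fun q _ =>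
      LatticeGapInUVUnits.Negative.abs_plaquetteCost_le r V _)
  have hdens : ∀ V : GaugeConfig 4 S G, dens G r x (torusLift S V) =
      (∑ _q : {q : Fin 4 × Fin 4 // q.1 < q.2}, (r.N : ℝ)) - P V := fun V => by
    rw [dens_torusLift_eq_sum, Finset.sum_sub_distrib]
  have hEP : Tendsto (fun β : ℝ => ∫ V, P V ∂(wilsonMeasure (d := 4) (L := S) r.ρ β)) atTop (𝓝 0) := by
    have h := tendsto_finsetSum (Finset.univ : Finset {q : Fin 4 × Fin 4 // q.1 < q.2})
      fun q _ => LatticeGapInUVUnits.Negative.tendsto_wilsonExpectation_plaquetteCost r S (Torus.proj S x, q)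
    simp only [Finset.sum_const_zero] at h
    refine h.congr' (Eventually.of_forall fun β => ?_)
    haveI := isProbabilityMeasure_wilsonMeasure (d := 4) (L := S) r.ρ r.continuous β
    change _ = ∫ V, ∑ q : {q : Fin 4 × Fin 4 // q.1 < q.2}, plaquetteCost r.ρ V (Torus.proj S x, q)
      ∂(wilsonMeasure (d := 4) (L := S) r.ρ β)
    rw [integral_finsetSum _ fun q _ => ?_]
    · rfl
    · exact Integrable.of_bound (LatticeGapInUVUnits.Negative.continuous_plaquetteCost r _).aestronglyMeasurable
        (2 * r.N) (Eventually.of_forall fun V => by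
          rw [Real.norm_eq_abs]; exact LatticeGapInUVUnits.Negative.abs_plaquetteCost_le r V _)
  -- |Cov| ≤ 2 C E[P]
  have hbound : ∀ β : ℝ, |torusE G r β L (fun U => dens G r x U * dens G r y U) -
      torusE G r β L (dens G r x) * torusE G r β L (dens G r y)| ≤
      2 * C * ∫ V, P V ∂(wilsonMeasure (d := 4) (L := S) r.ρ β) := by
    intro β
    haveI := isProbabilityMeasure_wilsonMeasure (d := 4) (L := S) r.ρ r.continuous β
    set μ := wilsonMeasure (d := 4) (L := S) r.ρ β with hμ
    have hAc : ∀ z : Fin 4 → ℤ, Continuous fun V : GaugeConfig 4 S G => dens G r z (torusLift S V) := fun z =>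
      (continuous_dens r z).comp (continuous_torusLift S)
    have hAi : ∀ z : Fin 4 → ℤ, Integrable (fun V : GaugeConfig 4 S G => dens G r z (torusLift S V)) μ := fun z =>
      Integrable.of_bound (hAc z).aestronglyMeasurable C
        (Eventually.of_forall fun V => by rw [Real.norm_eq_abs]; exact hCA z _)
    have hPi : Integrable P μ := Integrable.of_bound hPc.aestronglyMeasurable _
      (Eventually.of_forall fun V => by rw [Real.norm_eq_abs]; exact hPb V)
    have hPAi : Integrable (fun V => P V * dens G r y (torusLift S V)) μ :=
      Integrable.of_bound (hPc.mul (hAc y)).aestronglyMeasurable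
        ((∑ _q : {q : Fin 4 × Fin 4 // q.1 < q.2}, 2 * (r.N : ℝ)) * C)
        (Eventually.of_forall fun V => by
          rw [Real.norm_eq_abs, abs_mul]
          exact mul_le_mul (hPb V) (hCA y _) (abs_nonneg _) ((abs_nonneg _).trans (hPb V)))
    set K : ℝ := ∑ _q : {q : Fin 4 × Fin 4 // q.1 < q.2}, (r.N : ℝ) with hK
    set my : ℝ := ∫ V, dens G r y (torusLift S V) ∂μ with hmy
    have hmyC : |my| ≤ C := by
      rw [hmy]
      refine (abs_integral_le_integral_abs).trans ?_
      calc ∫ V, |dens G r y (torusLift S V)| ∂μ ≤ ∫ _V, C ∂μ :=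
            integral_mono (hAi y).abs (integrable_const C) fun V => hCA y _
        _ = C := by simp
    -- the two torus expectations, rewritten through `A_x = K − P`
    have h1 : torusE G r β L (fun U => dens G r x U * dens G r y U) =
        K * my - ∫ V, P V * dens G r y (torusLift S V) ∂μ := by
      change ∫ V, dens G r x (torusLift S V) * dens G r y (torusLift S V) ∂μ = _
      simp_rw [hdens, sub_mul]
      rw [integral_sub ((hAi y).const_mul K) hPAi, integral_const_mul]
    have h2 : torusE G r β L (dens G r x) = K - ∫ V, P V ∂μ := by
      change ∫ V, dens G r x (torusLift S V) ∂μ = _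
      simp_rw [hdens]
      rw [integral_sub (integrable_const K) hPi, integral_const]
      simp
    have h3 : torusE G r β L (dens G r y) = my := rfl
    rw [h1, h2, h3]
    have e : K * my - ∫ V, P V * dens G r y (torusLift S V) ∂μ - (K - ∫ V, P V ∂μ) * my =
        -(∫ V, P V * dens G r y (torusLift S V) ∂μ) + (∫ V, P V ∂μ) * my := by ring
    rw [e]
    have hI1 : |∫ V, P V * dens G r y (torusLift S V) ∂μ| ≤ C * ∫ V, P V ∂μ := by
      refine (abs_integral_le_integral_abs).trans ?_
      rw [← integral_const_mul]
      refine integral_mono hPAi.abs (hPi.const_mul C) fun V => ?_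
      rw [abs_mul, abs_of_nonneg (hP0 V), mul_comm C]
      exact mul_le_mul_of_nonneg_left (hCA y _) (hP0 V)
    have hI2 : |(∫ V, P V ∂μ) * my| ≤ C * ∫ V, P V ∂μ := by
      rw [abs_mul, abs_of_nonneg (integral_nonneg hP0), mul_comm C]
      exact mul_le_mul_of_nonneg_left hmyC (integral_nonneg hP0)
    calc |-(∫ V, P V * dens G r y (torusLift S V) ∂μ) + (∫ V, P V ∂μ) * my|
        ≤ |-(∫ V, P V * dens G r y (torusLift S V) ∂μ)| + |(∫ V, P V ∂μ) * my| := abs_add_le _ _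
      _ ≤ C * ∫ V, P V ∂μ + C * ∫ V, P V ∂μ := by rw [abs_neg]; exact add_le_add hI1 hI2
      _ = 2 * C * ∫ V, P V ∂μ := by ring
  have hlim : Tendsto (fun β : ℝ => 2 * C * ∫ V, P V ∂(wilsonMeasure (d := 4) (L := S) r.ρ β)) atTop (𝓝 0) := by
    simpa using hEP.const_mul (2 * C)
  exact squeeze_zero_norm (fun β => by rw [Real.norm_eq_abs]; exact hbound β) hlim

/-- Schwartz test functions are bounded. [folklore] -/
theorem exists_abs_schwartz_le (v : 𝓢(EuclideanSpace ℝ (Fin 4), ℝ)) :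
    ∃ M : ℝ, 0 ≤ M ∧ ∀ z, |v z| ≤ M := by
  refine ⟨‖v.toBoundedContinuousFunction‖, norm_nonneg _, fun z => ?_⟩
  have h := v.toBoundedContinuousFunction.norm_coe_le_norm z
  rwa [SchwartzMap.toBoundedContinuousFunction_apply, Real.norm_eq_abs] at h

/-- **`|Q2|` on a fixed torus is controlled by the covariances, uniformly in the resolution**:
`|Q2 G r β L s f g| ≤ M_f M_g Σ_{x,y ∈ box} |Cov_β(A_x, A_y)|`. [folklore] -/
theorem abs_Q2_le (β : ℝ) (L : ℕ) (s : ℝ) (f g : 𝓢(EuclideanSpace ℝ (Fin 4), ℝ)) {Mf Mg : ℝ}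
    (hMf : 0 ≤ Mf) (hf : ∀ z, |f z| ≤ Mf) (hg : ∀ z, |g z| ≤ Mg) :
    |Q2 G r β L s f g| ≤ Mf * Mg * ∑ x ∈ box 4 L, ∑ y ∈ box 4 L,
      |torusE G r β L (fun U => dens G r x U * dens G r y U) -
        torusE G r β L (dens G r x) * torusE G r β L (dens G r y)| := by
  unfold Q2
  rw [Finset.mul_sum]
  refine (Finset.abs_sum_le_sum_abs _ _).trans (Finset.sum_le_sum fun x _ => ?_)
  rw [Finset.mul_sum]
  refine (Finset.abs_sum_le_sum_abs _ _).trans (Finset.sum_le_sum fun y _ => ?_)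
  rw [abs_mul, abs_mul]
  have hMg : 0 ≤ Mg := (abs_nonneg _).trans (hg 0)
  exact mul_le_mul (mul_le_mul (hf _) (hg _) (abs_nonneg _) hMf) le_rfl (abs_nonneg _)
    (mul_nonneg hMf hMg)

/-- **U — `OnsetVanishes`** (stmt-QuantumFields-23315): for every datum, `ε > 0` and `s₀ > 0`, for all large
`β` no resolution `s ∈ [s₀, 1]` carries the floors — the `Q2`-floor already fails on the fixed torus
`L₀ = ⌈Λ₅/s₀⌉₊`, whose action-density covariances vanish as `β → ∞` (weak-coupling freezing of a finite
Gibbs measure), uniformly in `s` because the test-function weights are bounded. [folklore] -/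
theorem onsetVanishes_proof : Summit.QuantumFields.YangMills.Theses.OnsetCalibration.OnsetVanishes := by
  unfold Summit.QuantumFields.YangMills.Theses.OnsetCalibration.OnsetVanishes
  intro G _ _ _ _ hG hcl
  letI : MeasurableSpace G := borel G
  haveI : BorelSpace G := ⟨rfl⟩
  intro r v f g h ε Λ₅ s₀ hε hs₀
  -- the fixed torus
  set L₀ : ℕ := ⌈Λ₅ / s₀⌉₊ with hL₀
  have hΛ : ∀ s : ℝ, s₀ ≤ s → Λ₅ ≤ s * L₀ := by
    intro s hs
    have hs' : 0 < s := hs₀.trans_le hs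
    have h1 : Λ₅ / s₀ ≤ (L₀ : ℝ) := Nat.le_ceil _
    rcases le_or_gt 0 Λ₅ with hΛ0 | hΛ0
    · have h2 : Λ₅ / s ≤ Λ₅ / s₀ := div_le_div_of_nonneg_left hΛ0 hs₀ hs
      have h3 : Λ₅ / s ≤ L₀ := h2.trans h1
      rwa [div_le_iff₀ hs', mul_comm] at h3
    · exact hΛ0.le.trans (mul_nonneg hs'.le (Nat.cast_nonneg _))
  -- bounds on the two test functions, uniform in the resolution
  obtain ⟨Mθ, hMθ0, hMθ⟩ := exists_abs_schwartz_le (thetaTest 4 v)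
  obtain ⟨Mv, -, hMv⟩ := exists_abs_schwartz_le v
  -- the covariance sum on the fixed torus tends to zero
  have hT : Tendsto (fun β : ℝ => Mθ * Mv * ∑ x ∈ box 4 L₀, ∑ y ∈ box 4 L₀,
      |torusE G r β L₀ (fun U => dens G r x U * dens G r y U) -
        torusE G r β L₀ (dens G r x) * torusE G r β L₀ (dens G r y)|) atTop (𝓝 0) := by
    have h := tendsto_finsetSum (box 4 L₀) fun x _ => tendsto_finsetSum (box 4 L₀) fun y _ =>
      (tendsto_torusCov_dens r L₀ x y).abs
    simp only [abs_zero, Finset.sum_const_zero] at h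
    simpa using h.const_mul (Mθ * Mv)
  obtain ⟨β₁, hβ₁⟩ := Filter.eventually_atTop.1 ((tendsto_order.1 hT).2 ε hε)
  refine ⟨β₁, fun β hβ s hs0 hs1 hfl => ?_⟩
  have hfloor := hfl.1 L₀ (hΛ s hs0)
  have hQ := abs_Q2_le r β L₀ s (thetaTest 4 v) v hMθ0 hMθ hMv
  have hlt := hβ₁ β hβ
  linarith [le_abs_self (Q2 G r β L₀ s (thetaTest 4 v) v)]

end Summit.QuantumFields.YangMills.Theorems.OnsetCalibration

end
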